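import Literature.NumberTheory.LFunctions.MontgomeryVaughanLogMeans
import Literature.NumberTheory.LFunctions.ZetaClassicalRegionBounds
import Literature.NumberTheory.LFunctions.ZetaFractionalPartIntegral
import Literature.NumberTheory.LFunctions.PretentiousZeta
import Literature.NumberTheory.LFunctions.PerronTruncated
import Mathlib.NumberTheory.EulerProduct.ExpLog
import Mathlib.NumberTheory.EulerProduct.DirichletLSeries
import Mathlib.Analysis.SpecialFunctions.Complex.LogBounds
import Mathlib.Analysis.PSeries
import HarnessLib

/-!
# Proof of Montgomery–Vaughan 2001, Lemma 1: `(σ₁−1)/(σ₂−1) ≪ |F(σ₂)/F(σ₁)| ≪ (σ₂−1)/(σ₁−1)`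

Proofs for `MontgomeryVaughanLogMeans.lean` (no definitions, no named facts). DISCHARGES the named
fact `Literature.NumberTheory.LFunctions.MontgomeryVaughan2001_lemma1` (H. L. Montgomery,
R. C. Vaughan, *Mean values of multiplicative functions*, Period. Math. Hungar. 43 (2001), Lemma 1,
p. 208): for `f` totally multiplicative with `|f(n)| ≤ 1`, `F(s) = Σ f(n) n^{-s}`, and
`1 < σ₁ ≤ σ₂ ≤ 2`, `(σ₁ − 1)/(σ₂ − 1) ≪ |F(σ₂)/F(σ₁)| ≪ (σ₂ − 1)/(σ₁ − 1)` — as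
`MontgomeryVaughan2001_lemma1_holds`, with the absolute constant `C = e⁹` in the division-free
vendored form. (Lemma 1 is one of the two inputs, with Lemma 2, of the box estimates (23)–(24) by
which Theorem 3 is deduced from Theorem 2 in §3 of the paper; Theorem 3 ⇒ Theorem 4 is
`Literature/Barriers/RiemannHypothesis/TuranPartialSumsMVProofs.lean`.)

## The printed proof and its formalisation

"The quotient in question is `≍ exp(Re Σ_p f(p)(p^{-σ₂} − p^{-σ₁}))`. Since `|f(p)| ≤ 1`, this is
`≤ exp(Σ_p p^{-σ₁} − p^{-σ₂}) ≍ ζ(σ₁)/ζ(σ₂) ≍ (σ₂ − 1)/(σ₁ − 1)`. The lower bound is proved similarly."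

* Euler product in exponential form (Mathlib `EulerProduct.exp_tsum_primes_log_eq_tsum`) for the
  totally multiplicative `g_σ = f · n^{-σ} : ℕ →*₀ ℂ` (`f * riemannZetaSummandHom`), dominated by
  `n^{-σ}`: `|F(σ)| = exp(Re T_σ)`, `T_σ = Σ_p −log(1 − f(p)p^{-σ})` (`eulerPackage`,
  `tsum_mul_summandHom_eq_LSeries`); in particular `F(σ) ≠ 0`.
* The "`≍`": `|Re T_σ − Re Σ_p f(p)p^{-σ}| ≤ Σ_p 1/p² ≤ 2`, from `|−log(1 − z) − z| ≤ |z|²`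
  (`|z| ≤ 1/2`, the tree's `norm_neg_log_one_sub_sub_le` of `PretentiousZeta.lean`) and
  `|f(p)p^{-σ}| ≤ 1/p`
  (`abs_re_tsum_neg_log_sub_re_tsum_le`, `tsum_primes_one_div_sq_le_two` via `Σ 1/n² = π²/6`).
* `|Re Σ_p f(p)(p^{-σ₂} − p^{-σ₁})| ≤ Σ_p (p^{-σ₁} − p^{-σ₂}) = P(σ₁) − P(σ₂)` (`|f| ≤ 1`, `σ₁ ≤ σ₂`).
* `P(σ₁) − P(σ₂) ≤ log ζ(σ₁) − log ζ(σ₂) + 4 ≤ log 2 + log((σ₂−1)/(σ₁−1)) + 4`: the same machinery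
  for `f = 1` (`1 : ℕ →*₀ ℂ`, `LSeries_oneHom`) gives `|log ζ(σ) − P(σ)| ≤ 2` (`primeZeta_sub_le`),
  and `1/(σ−1) ≤ ζ(σ) ≤ 2/(σ−1)` on `(1, 2]` (`norm_zeta_ofReal_ge` from the tree's
  `riemannZeta_eq_sub_fractIntegral_of_one_lt_re` and `norm_fractIntegral_le`; `norm_zeta_ofReal_le`
  from the tree's `ZetaClassicalRegion.norm_riemannZeta_le_of_one_lt_re`).
* Hence `|log|F(σ₂)| − log|F(σ₁)|| ≤ 8 + log 2 + log((σ₂−1)/(σ₁−1)) ≤ 9 + log((σ₂−1)/(σ₁−1))`, which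
  exponentiates to both conjuncts with `C = e⁹`.

Toward Lemma 2 (p. 209): the same machinery at `s = σ + it` gives the printed reduction (20),
`|F(σ+it)/F(σ)| ≍ exp(Re Σ_p f(p)p^{-σ}(p^{-it} − 1)) ≤ exp(Σ_p p^{-σ}|p^{-it} − 1|)`
(`= exp(2Σ_p p^{-σ}|sin(½ t log p)|)`), proved two-sidedly with the explicit factor `e⁴`
(`MontgomeryVaughan2001.norm_LSeries_shift_le`), and the first range of Lemma 2, `|t| ≤ σ − 1`:
`|F(σ+it)| ≍ |F(σ)|` with an absolute constant
(`MontgomeryVaughan2001.exists_norm_LSeries_shift_le_of_abs_le`, via `|p^{-it} − 1| ≤ |t| log p` and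
the tree's `Σ Λ(n)n^{-σ} ≤ 1/(σ−1) + K₀`, `exists_tsum_vonMangoldt_div_rpow_le`); the remaining
steps of Lemma 2 (Mertens-type partial summation against `|sin|` for `σ − 1 ≤ |t| ≤ 2`, and for
`|t| ≥ 2` the Fourier series of `|sin πθ|` with `1/ζ(σ+it) ≪ log t`) are not in this file.

Axioms: `propext`, `Classical.choice`, `Quot.sound` only.

## References

* [MontgomeryVaughan2001] H. L. Montgomery, R. C. Vaughan, *Mean values of multiplicative functions*,
  Period. Math. Hungar. 43 (2001), 199–214, Lemma 1 and its proof, pp. 208–209, and (20) p. 209 (read); corroborated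
  by A. Roy, A. Vatwani, *Zeros of partial sums of L-functions* (2019), Lemma 7.1 at `k = 1`.
-/

noncomputable section

open Complex Filter
open scoped Topology

namespace Literature.NumberTheory.LFunctions

/-! ## Elementary bounds -/

/-- For a prime `p` and `σ ≥ 1`: `p^{-σ} ≤ 1/p`. [folklore] -/
theorem prime_rpow_neg_le_inv (p : Nat.Primes) {σ : ℝ} (hσ : 1 ≤ σ) :
    ((p : ℕ) : ℝ) ^ (-σ) ≤ 1 / ((p : ℕ) : ℝ) := by
  have hp : (1 : ℝ) ≤ (p : ℕ) := by exact_mod_cast p.prop.one_lt.le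
  calc ((p : ℕ) : ℝ) ^ (-σ) ≤ ((p : ℕ) : ℝ) ^ (-1 : ℝ) :=
        Real.rpow_le_rpow_of_exponent_le hp (by linarith)
    _ = 1 / ((p : ℕ) : ℝ) := by rw [Real.rpow_neg_one, one_div]

/-- For a prime `p`: `1/p ≤ 1/2`. [folklore] -/
theorem prime_inv_le_half (p : Nat.Primes) : 1 / ((p : ℕ) : ℝ) ≤ 1 / 2 := by
  have hp : (2 : ℝ) ≤ (p : ℕ) := by exact_mod_cast p.prop.two_le
  exact one_div_le_one_div_of_le two_pos hp

/-- `Σ_p 1/p²` converges (comparison with `Σ_n 1/n²`). [folklore] -/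
theorem summable_primes_one_div_sq : Summable fun p : Nat.Primes ↦ 1 / ((p : ℕ) : ℝ) ^ 2 :=
  (Real.summable_one_div_nat_pow.2 one_lt_two).subtype _

/-- `Σ_p 1/p² ≤ 2` (indeed `≤ Σ_n 1/n² = π²/6`). [folklore] -/
theorem tsum_primes_one_div_sq_le_two : ∑' p : Nat.Primes, 1 / ((p : ℕ) : ℝ) ^ 2 ≤ 2 := by
  have h1 : ∑' p : Nat.Primes, 1 / ((p : ℕ) : ℝ) ^ 2 ≤ ∑' n : ℕ, 1 / (n : ℝ) ^ 2 :=
    Summable.tsum_subtype_le (fun n : ℕ ↦ 1 / (n : ℝ) ^ 2) _ (fun n ↦ by positivity)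
      (Real.summable_one_div_nat_pow.2 one_lt_two)
  have h2 : ∑' n : ℕ, 1 / (n : ℝ) ^ 2 = Real.pi ^ 2 / 6 := hasSum_zeta_two.tsum_eq
  have h3 : Real.pi ^ 2 / 6 ≤ 2 := by
    have := Real.pi_lt_d2
    nlinarith [Real.pi_pos]
  linarith

/-- `Σ_p p^{-σ}` converges for `σ > 1`. [folklore] -/
theorem summable_primes_rpow_neg {σ : ℝ} (hσ : 1 < σ) :
    Summable fun p : Nat.Primes ↦ ((p : ℕ) : ℝ) ^ (-σ) :=
  (Real.summable_nat_rpow.2 (by linarith : -σ < -1)).subtype _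

/-! ## Euler products: `exp(Re Σ_p −log(1 − g(p))) = |Σ_n g(n)|` -/

/-- Pointwise product of two totally multiplicative functions. [folklore] -/
theorem mulHom_apply (f g : ℕ →*₀ ℂ) (n : ℕ) : (f * g) n = f n * g n := rfl

/-- For `g : ℕ →*₀ ℂ` dominated by `n^{-σ}`, `σ > 1`: the prime sum `T = Σ_p −log(1 − g(p))`
converges absolutely, so does `Σ_p g(p)`, and `exp(Re T) = |Σ_n g(n)|` (Euler product in Mathlib's
exponential form `EulerProduct.exp_tsum_primes_log_eq_tsum`). [folklore] -/
theorem eulerPackage {σ : ℝ} (hσ : 1 < σ) (g : ℕ →*₀ ℂ)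
    (hg : ∀ n : ℕ, ‖g n‖ ≤ (n : ℝ) ^ (-σ)) :
    Summable (fun p : Nat.Primes ↦ -log (1 - g p)) ∧
      Summable (fun p : Nat.Primes ↦ g p) ∧
      Real.exp ((∑' p : Nat.Primes, -log (1 - g p)).re) = ‖∑' n : ℕ, g n‖ := by
  have hsum : Summable (‖g ·‖) :=
    Summable.of_nonneg_of_le (fun n ↦ norm_nonneg _) hg (Real.summable_nat_rpow.2 (by linarith))
  have hE := EulerProduct.exp_tsum_primes_log_eq_tsum hsum
  refine ⟨?_, ?_, ?_⟩
  · exact (hsum.of_norm.clog_one_sub).neg.subtype _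
  · exact hsum.of_norm.subtype _
  · rw [← hE, norm_exp]

/-- The twist `g_σ(n) = f(n) n^{-σ}` of a totally multiplicative `f` with `|f| ≤ 1` is dominated by
`n^{-σ}`. [folklore] -/
theorem norm_mul_summandHom_le (f : ℕ →*₀ ℂ) (hf : ∀ n, ‖f n‖ ≤ 1) {σ : ℝ}
    (hσ0 : (σ : ℂ) ≠ 0) (n : ℕ) :
    ‖(f * riemannZetaSummandHom hσ0) n‖ ≤ (n : ℝ) ^ (-σ) := by
  rw [mulHom_apply, norm_mul]
  rcases Nat.eq_zero_or_pos n with rfl | hn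
  · simp only [Nat.cast_zero, map_zero, norm_zero, zero_mul]
    exact Real.rpow_nonneg le_rfl _
  have hns : ‖riemannZetaSummandHom hσ0 n‖ = (n : ℝ) ^ (-σ) := by
    show ‖(n : ℂ) ^ (-(σ : ℂ))‖ = (n : ℝ) ^ (-σ)
    rw [norm_natCast_cpow_of_pos hn]
    simp
  rw [hns]
  exact mul_le_of_le_one_left (Real.rpow_nonneg (Nat.cast_nonneg n) _) (hf n)

/-- `Σ_n f(n) n^{-σ} = F(σ)` (Mathlib's `LSeries`). [folklore] -/
theorem tsum_mul_summandHom_eq_LSeries (f : ℕ →*₀ ℂ) {σ : ℝ} (hσ0 : (σ : ℂ) ≠ 0) :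
    ∑' n : ℕ, (f * riemannZetaSummandHom hσ0) n = LSeries (f ·) σ := by
  rw [LSeries]
  refine tsum_congr fun n ↦ ?_
  rcases eq_or_ne n 0 with rfl | hn
  · rw [LSeries.term_zero, map_zero]
  rw [LSeries.term_of_ne_zero hn, mulHom_apply]
  show f n * (n : ℂ) ^ (-(σ : ℂ)) = f n / (n : ℂ) ^ (σ : ℂ)
  rw [cpow_neg, div_eq_mul_inv]

/-- **The second-order terms are uniformly bounded**: for `g : ℕ →*₀ ℂ` dominated by `n^{-σ}`,
`σ > 1`, `|Re Σ_p −log(1 − g(p)) − Re Σ_p g(p)| ≤ Σ_p 1/p²` (termwise `|−log(1−z) − z| ≤ |z|² ≤ 1/p²`,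
as `|z| ≤ p^{-σ} ≤ 1/p ≤ 1/2`). This is the "`≍`" in "The quotient in question is
`≍ exp(Re Σ_p f(p)(p^{-σ₂} − p^{-σ₁}))`" (proof of Lemma 1).
[cite: MontgomeryVaughan2001, Lemma 1 (proof)] -/
theorem abs_re_tsum_neg_log_sub_re_tsum_le {σ : ℝ} (hσ : 1 < σ) (g : ℕ →*₀ ℂ)
    (hg : ∀ n : ℕ, ‖g n‖ ≤ (n : ℝ) ^ (-σ)) :
    |(∑' p : Nat.Primes, -log (1 - g p)).re - (∑' p : Nat.Primes, g p).re| ≤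
      ∑' p : Nat.Primes, 1 / ((p : ℕ) : ℝ) ^ 2 := by
  obtain ⟨hT, hG, -⟩ := eulerPackage hσ g hg
  have hdiff : (∑' p : Nat.Primes, -log (1 - g p)) - (∑' p : Nat.Primes, g p) =
      ∑' p : Nat.Primes, (-log (1 - g p) - g p) := (hT.tsum_sub hG).symm
  rw [← sub_re, hdiff, Complex.re_tsum (hT.sub hG)]
  have hb : ∀ p : Nat.Primes, ‖(-log (1 - g p) - g p).re‖ ≤ 1 / ((p : ℕ) : ℝ) ^ 2 := by
    intro p
    have h1 : ‖g p‖ ≤ 1 / ((p : ℕ) : ℝ) := (hg p).trans (prime_rpow_neg_le_inv p hσ.le)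
    have h2 : ‖g p‖ ≤ 1 / 2 := h1.trans (prime_inv_le_half p)
    rw [Real.norm_eq_abs]
    calc |(-log (1 - g p) - g p).re| ≤ ‖-log (1 - g p) - g p‖ := abs_re_le_norm _
      _ ≤ ‖g p‖ ^ 2 := norm_neg_log_one_sub_sub_le h2
      _ ≤ (1 / ((p : ℕ) : ℝ)) ^ 2 := pow_le_pow_left₀ (norm_nonneg _) h1 2
      _ = 1 / ((p : ℕ) : ℝ) ^ 2 := by rw [one_div_pow]
  have := tsum_of_norm_bounded summable_primes_one_div_sq.hasSum hb
  rwa [Real.norm_eq_abs] at this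

/-! ## `ζ(σ)` on `(1, 2]` -/

/-- `|ζ(σ)| ≤ 2/(σ − 1)` for `1 < σ ≤ 2` (from the tree's `‖ζ(s)‖ ≤ σ/(σ−1)`). [folklore] -/
theorem norm_zeta_ofReal_le {σ : ℝ} (hσ : 1 < σ) (hσ2 : σ ≤ 2) :
    ‖riemannZeta σ‖ ≤ 2 / (σ - 1) := by
  have h := ZetaClassicalRegion.norm_riemannZeta_le_of_one_lt_re (s := σ) (by simpa using hσ)
  simp only [ofReal_re] at h
  exact h.trans (div_le_div_of_nonneg_right hσ2 (by linarith))

/-- `|ζ(σ)| ≥ 1/(σ − 1)` for real `σ > 1` (from `ζ(s) = s/(s−1) − s ∫_1^∞ {x}x^{-s-1}dx` and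
`|∫| ≤ 1/σ`, the tree's `riemannZeta_eq_sub_fractIntegral_of_one_lt_re`, `norm_fractIntegral_le`).
[folklore] -/
theorem norm_zeta_ofReal_ge {σ : ℝ} (hσ : 1 < σ) : 1 / (σ - 1) ≤ ‖riemannZeta σ‖ := by
  have hs : 1 < (σ : ℂ).re := by simpa using hσ
  have h := riemannZeta_eq_sub_fractIntegral_of_one_lt_re hs
  have hI := norm_fractIntegral_le (s := σ) (by simp only [ofReal_re]; linarith)
  simp only [ofReal_re] at hI
  have hσ0 : 0 < σ := by linarith
  have h1 : ‖(σ : ℂ) / ((σ : ℂ) - 1)‖ = σ / (σ - 1) := by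
    rw [show (σ : ℂ) - 1 = ((σ - 1 : ℝ) : ℂ) by push_cast; ring, ← ofReal_div, norm_real,
      Real.norm_eq_abs, abs_of_pos (div_pos hσ0 (by linarith))]
  have h2 : ‖(σ : ℂ) * fractIntegral σ‖ ≤ 1 := by
    rw [norm_mul, norm_real, Real.norm_eq_abs, abs_of_pos hσ0]
    calc σ * ‖fractIntegral σ‖ ≤ σ * (1 / σ) := mul_le_mul_of_nonneg_left hI hσ0.le
      _ = 1 := by field_simp
  rw [h]
  have hσ1 : σ - 1 ≠ 0 := by linarith
  calc 1 / (σ - 1) = σ / (σ - 1) - 1 := by field_simp; ring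
    _ ≤ ‖(σ : ℂ) / ((σ : ℂ) - 1)‖ - ‖(σ : ℂ) * fractIntegral σ‖ := by rw [h1]; linarith
    _ ≤ ‖(σ : ℂ) / ((σ : ℂ) - 1) - (σ : ℂ) * fractIntegral σ‖ := norm_sub_norm_le _ _

/-! ## The trivial twist `f = 1` and the prime zeta sums `P(σ) = Σ_p p^{-σ}` -/

/-- `|1(n)| ≤ 1` for the trivial totally multiplicative function (`1(0) = 0`, `1(n) = 1` else).
[folklore] -/
theorem norm_oneHom_le (n : ℕ) : ‖(1 : ℕ →*₀ ℂ) n‖ ≤ 1 := by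
  rw [MonoidWithZeroHom.one_apply_def]
  split_ifs <;> simp

/-- `LSeries` of the trivial twist is `ζ`. [folklore] -/
theorem LSeries_oneHom {σ : ℝ} (hσ : 1 < σ) :
    LSeries ((1 : ℕ →*₀ ℂ) ·) σ = riemannZeta σ := by
  rw [← LSeries_one_eq_riemannZeta (by simpa using hσ)]
  refine LSeries_congr (s := (σ : ℂ)) fun {n} hn ↦ ?_
  rw [MonoidWithZeroHom.one_apply_def, if_neg hn, Pi.one_apply]

/-- The prime sum of the twist: `Σ_p (f·n^{-σ})(p) = Σ_p f(p) p^{-σ}`, and for `f = 1` its real part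
is `P(σ) = Σ_p p^{-σ}`. [folklore] -/
theorem re_tsum_primes_oneHom_mul {σ : ℝ} (hσ0 : (σ : ℂ) ≠ 0) :
    (∑' p : Nat.Primes, ((1 : ℕ →*₀ ℂ) * riemannZetaSummandHom hσ0) p).re =
      ∑' p : Nat.Primes, ((p : ℕ) : ℝ) ^ (-σ) := by
  have : ∀ p : Nat.Primes, ((1 : ℕ →*₀ ℂ) * riemannZetaSummandHom hσ0) p =
      ((((p : ℕ) : ℝ) ^ (-σ) : ℝ) : ℂ) := by
    intro p
    rw [mulHom_apply, MonoidWithZeroHom.one_apply_def, if_neg p.prop.ne_zero, one_mul]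
    show ((p : ℕ) : ℂ) ^ (-(σ : ℂ)) = _
    rw [ofReal_cpow (Nat.cast_nonneg _), ofReal_natCast, ofReal_neg]
  rw [tsum_congr this, ← ofReal_tsum, ofReal_re]

/-- `P(σ₁) − P(σ₂) ≤ log(2/(σ₁−1)) − log(1/(σ₂−1)) + 2 Σ_p 1/p²` for `1 < σ₁ ≤ 2`, `1 < σ₂`: by the
Euler product, `|log ζ(σ) − P(σ)| ≤ Σ_p 1/p²`, and `1/(σ−1) ≤ ζ(σ) ≤ 2/(σ−1)`.
[cite: MontgomeryVaughan2001, Lemma 1 (proof)] -/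
theorem primeZeta_sub_le {σ₁ σ₂ : ℝ} (hσ₁ : 1 < σ₁) (hσ₁2 : σ₁ ≤ 2) (hσ₂ : 1 < σ₂) :
    (∑' p : Nat.Primes, ((p : ℕ) : ℝ) ^ (-σ₁)) - (∑' p : Nat.Primes, ((p : ℕ) : ℝ) ^ (-σ₂)) ≤
      Real.log (2 / (σ₁ - 1)) - Real.log (1 / (σ₂ - 1)) +
        2 * ∑' p : Nat.Primes, 1 / ((p : ℕ) : ℝ) ^ 2 := by
  have hne : ∀ σ : ℝ, 1 < σ → (σ : ℂ) ≠ 0 := fun σ hσ ↦ by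
    exact_mod_cast (by linarith : σ ≠ 0)
  -- the machinery for `f = 1` at `σ`
  have key : ∀ σ : ℝ, 1 < σ →
      |Real.log ‖riemannZeta σ‖ - ∑' p : Nat.Primes, ((p : ℕ) : ℝ) ^ (-σ)| ≤
        ∑' p : Nat.Primes, 1 / ((p : ℕ) : ℝ) ^ 2 := by
    intro σ hσ
    set g : ℕ →*₀ ℂ := (1 : ℕ →*₀ ℂ) * riemannZetaSummandHom (hne σ hσ) with hgdef
    have hg := norm_mul_summandHom_le (1 : ℕ →*₀ ℂ) norm_oneHom_le (hne σ hσ)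
    obtain ⟨-, -, hE⟩ := eulerPackage hσ g hg
    rw [tsum_mul_summandHom_eq_LSeries, LSeries_oneHom hσ] at hE
    have hA := abs_re_tsum_neg_log_sub_re_tsum_le hσ g hg
    rw [re_tsum_primes_oneHom_mul (hne σ hσ)] at hA
    have hlog : Real.log ‖riemannZeta σ‖ = (∑' p : Nat.Primes, -log (1 - g p)).re := by
      rw [← hE, Real.log_exp]
    rwa [hlog]
  have h1 := key σ₁ hσ₁
  have h2 := key σ₂ hσ₂
  have hz1 : Real.log ‖riemannZeta σ₁‖ ≤ Real.log (2 / (σ₁ - 1)) :=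
    Real.log_le_log (lt_of_lt_of_le (by positivity) (norm_zeta_ofReal_ge hσ₁))
      (norm_zeta_ofReal_le hσ₁ hσ₁2)
  have hz2 : Real.log (1 / (σ₂ - 1)) ≤ Real.log ‖riemannZeta σ₂‖ :=
    Real.log_le_log (by positivity) (norm_zeta_ofReal_ge hσ₂)
  have := (abs_le.1 h1).1
  have := (abs_le.1 h2).2
  linarith

/-! ## Lemma 1 -/

/-- **Montgomery–Vaughan 2001, Lemma 1 — proved** (discharge of `MontgomeryVaughan2001_lemma1`, with the
constant `C = e⁹`). Proof as printed: `|F(σ)| = exp(Re Σ_p −log(1 − f(p)p^{-σ}))` (Euler product), the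
terms beyond `f(p)p^{-σ}` contribute at most `Σ_p 1/p² ≤ 2` at each of `σ₁, σ₂`, and
`|Re Σ_p f(p)(p^{-σ₂} − p^{-σ₁})| ≤ Σ_p (p^{-σ₁} − p^{-σ₂}) = P(σ₁) − P(σ₂) ≤ log(ζ(σ₁)/ζ(σ₂)) + 4
≤ log 2 + 4 + log((σ₂−1)/(σ₁−1))`; so `|log|F(σ₂)/F(σ₁)|| ≤ 8 + log 2 + log((σ₂−1)/(σ₁−1))`.
[cite: MontgomeryVaughan2001, Lemma 1] -/
theorem MontgomeryVaughan2001_lemma1_holds : MontgomeryVaughan2001_lemma1 := by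
  refine ⟨Real.exp 9, Real.exp_pos 9, fun f hf σ₁ σ₂ hσ₁ h12 hσ₂ ↦ ?_⟩
  have hσ₂' : 1 < σ₂ := lt_of_lt_of_le hσ₁ h12
  have hne : ∀ σ : ℝ, 1 < σ → (σ : ℂ) ≠ 0 := fun σ hσ ↦ by
    exact_mod_cast (by linarith : σ ≠ 0)
  set Z : ℝ := ∑' p : Nat.Primes, 1 / ((p : ℕ) : ℝ) ^ 2 with hZ
  have hZ2 : Z ≤ 2 := tsum_primes_one_div_sq_le_two
  -- the twists `g_i(n) = f(n) n^{-σ_i}`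
  set g₁ : ℕ →*₀ ℂ := f * riemannZetaSummandHom (hne σ₁ hσ₁) with hg₁def
  set g₂ : ℕ →*₀ ℂ := f * riemannZetaSummandHom (hne σ₂ hσ₂') with hg₂def
  have hg₁ := norm_mul_summandHom_le f hf (hne σ₁ hσ₁)
  have hg₂ := norm_mul_summandHom_le f hf (hne σ₂ hσ₂')
  obtain ⟨-, hG₁, hE₁⟩ := eulerPackage hσ₁ g₁ hg₁
  obtain ⟨-, hG₂, hE₂⟩ := eulerPackage hσ₂' g₂ hg₂
  rw [tsum_mul_summandHom_eq_LSeries] at hE₁ hE₂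
  set T₁ : ℝ := (∑' p : Nat.Primes, -log (1 - g₁ p)).re with hT₁
  set T₂ : ℝ := (∑' p : Nat.Primes, -log (1 - g₂ p)).re with hT₂
  have hA₁ := abs_re_tsum_neg_log_sub_re_tsum_le hσ₁ g₁ hg₁
  have hA₂ := abs_re_tsum_neg_log_sub_re_tsum_le hσ₂' g₂ hg₂
  -- `|Re Σ_p g₂(p) − Re Σ_p g₁(p)| ≤ P(σ₁) − P(σ₂)`
  set P₁ : ℝ := ∑' p : Nat.Primes, ((p : ℕ) : ℝ) ^ (-σ₁) with hP₁
  set P₂ : ℝ := ∑' p : Nat.Primes, ((p : ℕ) : ℝ) ^ (-σ₂) with hP₂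
  have hB : |(∑' p : Nat.Primes, g₂ p).re - (∑' p : Nat.Primes, g₁ p).re| ≤ P₁ - P₂ := by
    rw [← sub_re, ← hG₂.tsum_sub hG₁]
    refine (abs_re_le_norm _).trans ?_
    have hsum : HasSum (fun p : Nat.Primes ↦ ((p : ℕ) : ℝ) ^ (-σ₁) - ((p : ℕ) : ℝ) ^ (-σ₂))
        (P₁ - P₂) :=
      (summable_primes_rpow_neg hσ₁).hasSum.sub (summable_primes_rpow_neg hσ₂').hasSum
    refine tsum_of_norm_bounded hsum fun p ↦ ?_
    have hp0 : (0 : ℝ) ≤ (p : ℕ) := Nat.cast_nonneg _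
    have hp1 : (1 : ℝ) ≤ (p : ℕ) := by exact_mod_cast p.prop.one_lt.le
    have e : g₂ p - g₁ p = f p * (((((p : ℕ) : ℝ) ^ (-σ₂) : ℝ) : ℂ) - ((((p : ℕ) : ℝ) ^ (-σ₁) : ℝ) : ℂ)) := by
      rw [hg₂def, hg₁def, mulHom_apply, mulHom_apply]
      show f p * ((p : ℕ) : ℂ) ^ (-(σ₂ : ℂ)) - f p * ((p : ℕ) : ℂ) ^ (-(σ₁ : ℂ)) = _
      rw [ofReal_cpow hp0, ofReal_cpow hp0, ofReal_natCast, ofReal_neg, ofReal_neg]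
      ring
    rw [e, norm_mul, ← ofReal_sub, norm_real, Real.norm_eq_abs]
    have hmono : ((p : ℕ) : ℝ) ^ (-σ₂) ≤ ((p : ℕ) : ℝ) ^ (-σ₁) :=
      Real.rpow_le_rpow_of_exponent_le hp1 (by linarith)
    rw [abs_of_nonpos (by linarith), neg_sub]
    calc ‖f p‖ * (((p : ℕ) : ℝ) ^ (-σ₁) - ((p : ℕ) : ℝ) ^ (-σ₂))
        ≤ 1 * (((p : ℕ) : ℝ) ^ (-σ₁) - ((p : ℕ) : ℝ) ^ (-σ₂)) :=
          mul_le_mul_of_nonneg_right (hf p) (by linarith)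
      _ = _ := one_mul _
  -- `P(σ₁) − P(σ₂) ≤ log 2 + log((σ₂−1)/(σ₁−1)) + 2Z`
  have hC := primeZeta_sub_le hσ₁ (h12.trans hσ₂) hσ₂'
  have hlog : Real.log (2 / (σ₁ - 1)) - Real.log (1 / (σ₂ - 1)) =
      Real.log 2 + Real.log ((σ₂ - 1) / (σ₁ - 1)) := by
    rw [Real.log_div (by norm_num) (by linarith), Real.log_div (by norm_num) (by linarith),
      Real.log_div (by linarith) (by linarith), Real.log_one]
    ring
  have hlog2 : Real.log 2 < 1 := by
    have := Real.log_two_lt_d9; linarith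
  -- `|T₂ − T₁| ≤ 9 + log((σ₂−1)/(σ₁−1))`
  set L : ℝ := Real.log ((σ₂ - 1) / (σ₁ - 1)) with hL
  have hD : |T₂ - T₁| ≤ 9 + L := by
    rw [abs_le]
    have a1 := abs_le.1 hA₁
    have a2 := abs_le.1 hA₂
    have b := abs_le.1 hB
    constructor <;> linarith [a1.1, a1.2, a2.1, a2.2, b.1, b.2]
  -- conclusion
  have hr : 0 < (σ₂ - 1) / (σ₁ - 1) := by positivity
  have hexpL : Real.exp L = (σ₂ - 1) / (σ₁ - 1) := by rw [hL, Real.exp_log hr]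
  have hF₁ : ‖LSeries (f ·) σ₁‖ = Real.exp T₁ := hE₁.symm
  have hF₂ : ‖LSeries (f ·) σ₂‖ = Real.exp T₂ := hE₂.symm
  have hD' := abs_le.1 hD
  have hσ1ne : σ₁ - 1 ≠ 0 := by linarith
  constructor
  · rw [hF₁, hF₂]
    have h2 : Real.exp T₁ ≤ Real.exp T₂ * (Real.exp 9 * ((σ₂ - 1) / (σ₁ - 1))) := by
      rw [← hexpL, ← Real.exp_add, ← Real.exp_add]
      exact Real.exp_le_exp.2 (by linarith [hD'.1])
    calc (σ₁ - 1) * Real.exp T₁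
        ≤ (σ₁ - 1) * (Real.exp T₂ * (Real.exp 9 * ((σ₂ - 1) / (σ₁ - 1)))) :=
          mul_le_mul_of_nonneg_left h2 (by linarith)
      _ = Real.exp 9 * (σ₂ - 1) * Real.exp T₂ := by field_simp
  · rw [hF₁, hF₂]
    have h2 : Real.exp T₂ ≤ Real.exp T₁ * (Real.exp 9 * ((σ₂ - 1) / (σ₁ - 1))) := by
      rw [← hexpL, ← Real.exp_add, ← Real.exp_add]
      exact Real.exp_le_exp.2 (by linarith [hD'.2])
    calc (σ₁ - 1) * Real.exp T₂
        ≤ (σ₁ - 1) * (Real.exp T₁ * (Real.exp 9 * ((σ₂ - 1) / (σ₁ - 1)))) :=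
          mul_le_mul_of_nonneg_left h2 (by linarith)
      _ = Real.exp 9 * (σ₂ - 1) * Real.exp T₁ := by field_simp

/-! ## The oscillation reduction (20): `|F(σ+it)/F(σ)| ≍ exp(Re Σ_p f(p)p^{-σ}(p^{-it} − 1))` -/

/-- Complex-`s` version of `norm_mul_summandHom_le`: `|f(n) n^{-s}| ≤ n^{-Re s}`. [folklore] -/
theorem norm_mul_summandHom_le' (f : ℕ →*₀ ℂ) (hf : ∀ n, ‖f n‖ ≤ 1) {s : ℂ} (hs0 : s ≠ 0)
    (n : ℕ) : ‖(f * riemannZetaSummandHom hs0) n‖ ≤ (n : ℝ) ^ (-s.re) := by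
  rw [mulHom_apply, norm_mul]
  rcases Nat.eq_zero_or_pos n with rfl | hn
  · simp only [Nat.cast_zero, map_zero, norm_zero, zero_mul]
    exact Real.rpow_nonneg le_rfl _
  have hns : ‖riemannZetaSummandHom hs0 n‖ = (n : ℝ) ^ (-s.re) := by
    show ‖(n : ℂ) ^ (-s)‖ = (n : ℝ) ^ (-s.re)
    rw [norm_natCast_cpow_of_pos hn, neg_re]
  rw [hns]
  exact mul_le_of_le_one_left (Real.rpow_nonneg (Nat.cast_nonneg n) _) (hf n)

/-- Complex-`s` version of `tsum_mul_summandHom_eq_LSeries`: `Σ_n f(n) n^{-s} = F(s)`. [folklore] -/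
theorem tsum_mul_summandHom_eq_LSeries' (f : ℕ →*₀ ℂ) {s : ℂ} (hs0 : s ≠ 0) :
    ∑' n : ℕ, (f * riemannZetaSummandHom hs0) n = LSeries (f ·) s := by
  rw [LSeries]
  refine tsum_congr fun n ↦ ?_
  rcases eq_or_ne n 0 with rfl | hn
  · rw [LSeries.term_zero, map_zero]
  rw [LSeries.term_of_ne_zero hn, mulHom_apply]
  show f n * (n : ℂ) ^ (-s) = f n / (n : ℂ) ^ s
  rw [cpow_neg, div_eq_mul_inv]

/-- `Σ_p p^{-σ} |p^{-it} − 1|` converges for `σ > 1` (terms `≤ 2p^{-σ}`). [folklore] -/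
theorem summable_primes_rpow_mul_norm_twist_sub_one {σ : ℝ} (hσ : 1 < σ) (t : ℝ) :
    Summable fun p : Nat.Primes ↦ ((p : ℕ) : ℝ) ^ (-σ) * ‖((p : ℕ) : ℂ) ^ (-(t * I)) - 1‖ := by
  refine Summable.of_nonneg_of_le (fun p ↦ by positivity) (fun p ↦ ?_)
    ((summable_primes_rpow_neg hσ).mul_left 2)
  have h1 : ‖((p : ℕ) : ℂ) ^ (-(t * I)) - 1‖ ≤ 2 := by
    refine (norm_sub_le _ _).trans ?_
    rw [norm_one, norm_natCast_cpow_of_pos p.prop.pos]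
    simp
    norm_num
  calc ((p : ℕ) : ℝ) ^ (-σ) * ‖((p : ℕ) : ℂ) ^ (-(t * I)) - 1‖ ≤ ((p : ℕ) : ℝ) ^ (-σ) * 2 :=
        mul_le_mul_of_nonneg_left h1 (Real.rpow_nonneg (Nat.cast_nonneg _) _)
    _ = 2 * ((p : ℕ) : ℝ) ^ (-σ) := mul_comm _ _

/-- **Montgomery–Vaughan 2001, (20) (proof of Lemma 2), proved in two-sided form**: for `f` totally
multiplicative with `|f| ≤ 1`, `σ > 1`, real `t`, and `S = Σ_p p^{-σ}|p^{-it} − 1|`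
(`= 2 Σ_p p^{-σ}|sin(½ t log p)|`):  `|F(σ+it)| ≤ e⁴ e^{S} |F(σ)|` and `|F(σ)| ≤ e⁴ e^{S} |F(σ+it)|`.
Source: "the quotient in question has modulus `≍ exp(Re Σ_p f(p) p^{-σ}(p^{-it} − 1))
≤ exp(2 Σ_p p^{-σ}|sin(½ t log p)|)`" — here with the explicit factor `e⁴` for the "`≍`"
(`2 Σ_p 1/p² ≤ 4` at each of `σ`, `σ + it`, by `abs_re_tsum_neg_log_sub_re_tsum_le`).
[cite: MontgomeryVaughan2001, Lemma 2 (proof, (20))] -/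
theorem MontgomeryVaughan2001.norm_LSeries_shift_le (f : ℕ →*₀ ℂ) (hf : ∀ n, ‖f n‖ ≤ 1)
    {σ : ℝ} (hσ : 1 < σ) (t : ℝ) :
    ‖LSeries (f ·) (σ + t * I)‖ ≤ Real.exp 4 *
        Real.exp (∑' p : Nat.Primes, ((p : ℕ) : ℝ) ^ (-σ) * ‖((p : ℕ) : ℂ) ^ (-(t * I)) - 1‖) *
          ‖LSeries (f ·) σ‖ ∧
      ‖LSeries (f ·) σ‖ ≤ Real.exp 4 *
        Real.exp (∑' p : Nat.Primes, ((p : ℕ) : ℝ) ^ (-σ) * ‖((p : ℕ) : ℂ) ^ (-(t * I)) - 1‖) *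
          ‖LSeries (f ·) (σ + t * I)‖ := by
  set s : ℂ := σ + t * I with hsdef
  have hsre : s.re = σ := by simp [hsdef]
  have hs0 : s ≠ 0 := fun h ↦ by
    have := congrArg Complex.re h
    rw [hsre, zero_re] at this
    linarith
  have hσ0 : (σ : ℂ) ≠ 0 := by exact_mod_cast (by linarith : σ ≠ 0)
  set Z : ℝ := ∑' p : Nat.Primes, 1 / ((p : ℕ) : ℝ) ^ 2 with hZ
  have hZ2 : Z ≤ 2 := tsum_primes_one_div_sq_le_two
  set S : ℝ := ∑' p : Nat.Primes, ((p : ℕ) : ℝ) ^ (-σ) * ‖((p : ℕ) : ℂ) ^ (-(t * I)) - 1‖ with hS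
  -- the two twists
  set gt : ℕ →*₀ ℂ := f * riemannZetaSummandHom hs0 with hgtdef
  set g0 : ℕ →*₀ ℂ := f * riemannZetaSummandHom hσ0 with hg0def
  have hgt : ∀ n : ℕ, ‖gt n‖ ≤ (n : ℝ) ^ (-σ) := fun n ↦ by
    have := norm_mul_summandHom_le' f hf hs0 n
    rwa [hsre] at this
  have hg0 := norm_mul_summandHom_le f hf hσ0
  obtain ⟨-, hGt, hEt⟩ := eulerPackage hσ gt hgt
  obtain ⟨-, hG0, hE0⟩ := eulerPackage hσ g0 hg0
  rw [tsum_mul_summandHom_eq_LSeries'] at hEt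
  rw [tsum_mul_summandHom_eq_LSeries] at hE0
  set Tt : ℝ := (∑' p : Nat.Primes, -log (1 - gt p)).re with hTt
  set T0 : ℝ := (∑' p : Nat.Primes, -log (1 - g0 p)).re with hT0
  have hAt := abs_re_tsum_neg_log_sub_re_tsum_le hσ gt hgt
  have hA0 := abs_re_tsum_neg_log_sub_re_tsum_le hσ g0 hg0
  -- `|Re Σ_p gt(p) − Re Σ_p g0(p)| ≤ S`
  have hB : |(∑' p : Nat.Primes, gt p).re - (∑' p : Nat.Primes, g0 p).re| ≤ S := by
    rw [← sub_re, ← hGt.tsum_sub hG0]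
    refine (abs_re_le_norm _).trans ?_
    refine tsum_of_norm_bounded (summable_primes_rpow_mul_norm_twist_sub_one hσ t).hasSum
      fun p ↦ ?_
    have hp0 : (0 : ℝ) ≤ (p : ℕ) := Nat.cast_nonneg _
    have hpc : ((p : ℕ) : ℂ) ≠ 0 := Nat.cast_ne_zero.2 p.prop.ne_zero
    have e : gt p - g0 p =
        f p * (((((p : ℕ) : ℝ) ^ (-σ) : ℝ) : ℂ) * (((p : ℕ) : ℂ) ^ (-(t * I)) - 1)) := by
      rw [hgtdef, hg0def, mulHom_apply, mulHom_apply]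
      show f p * ((p : ℕ) : ℂ) ^ (-s) - f p * ((p : ℕ) : ℂ) ^ (-(σ : ℂ)) = _
      rw [hsdef, neg_add, cpow_add _ _ hpc, ofReal_cpow hp0, ofReal_natCast, ofReal_neg]
      ring
    rw [e, norm_mul, norm_mul, norm_real, Real.norm_eq_abs,
      abs_of_nonneg (Real.rpow_nonneg hp0 _)]
    calc ‖f p‖ * (((p : ℕ) : ℝ) ^ (-σ) * ‖((p : ℕ) : ℂ) ^ (-(t * I)) - 1‖)
        ≤ 1 * (((p : ℕ) : ℝ) ^ (-σ) * ‖((p : ℕ) : ℂ) ^ (-(t * I)) - 1‖) :=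
          mul_le_mul_of_nonneg_right (hf p) (by positivity)
      _ = _ := one_mul _
  -- `|Tt − T0| ≤ 4 + S`
  have hD : |Tt - T0| ≤ 4 + S := by
    rw [abs_le]
    have a1 := abs_le.1 hAt
    have a2 := abs_le.1 hA0
    have b := abs_le.1 hB
    constructor <;> linarith [a1.1, a1.2, a2.1, a2.2, b.1, b.2]
  have hD' := abs_le.1 hD
  have hFt : ‖LSeries (f ·) s‖ = Real.exp Tt := hEt.symm
  have hF0 : ‖LSeries (f ·) σ‖ = Real.exp T0 := hE0.symm
  refine ⟨?_, ?_⟩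
  · rw [hFt, hF0, ← Real.exp_add, ← Real.exp_add]
    exact Real.exp_le_exp.2 (by linarith [hD'.2])
  · rw [hFt, hF0, ← Real.exp_add, ← Real.exp_add]
    exact Real.exp_le_exp.2 (by linarith [hD'.1])

/-! ## Lemma 2, first range: `|t| ≤ σ − 1` -/

/-- `|p^{-it} − 1| ≤ |t| log p` (`e^{ix}` is `1`-Lipschitz). [folklore] -/
theorem norm_natCast_cpow_neg_mul_I_sub_one_le (p : Nat.Primes) (t : ℝ) :
    ‖((p : ℕ) : ℂ) ^ (-(t * I)) - 1‖ ≤ |t| * Real.log p := by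
  have hp0 : ((p : ℕ) : ℂ) ≠ 0 := Nat.cast_ne_zero.2 p.prop.ne_zero
  have hlog : 0 ≤ Real.log p := Real.log_nonneg (by exact_mod_cast p.prop.one_lt.le)
  have e : ((p : ℕ) : ℂ) ^ (-(t * I)) = exp (I * ((-(t * Real.log p) : ℝ) : ℂ)) := by
    rw [cpow_def_of_ne_zero hp0, ← natCast_log]
    congr 1
    push_cast
    ring
  rw [e]
  refine (Real.norm_exp_I_mul_ofReal_sub_one_le).trans ?_
  rw [Real.norm_eq_abs, abs_neg, abs_mul, abs_of_nonneg hlog]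

/-- `Σ_p log p · p^{-σ} ≤ Σ_n Λ(n) n^{-σ} ≤ 1/(σ − 1) + K₀` for `1 < σ ≤ 2` (the tree's crude
`−ζ'/ζ(σ) = 1/(σ−1) + O(1)`, `exists_tsum_vonMangoldt_div_rpow_le`). [folklore] -/
theorem exists_tsum_primes_log_mul_rpow_le :
    ∃ K₀ : ℝ, 0 ≤ K₀ ∧ ∀ σ : ℝ, 1 < σ → σ ≤ 2 →
      Summable (fun p : Nat.Primes ↦ Real.log p * ((p : ℕ) : ℝ) ^ (-σ)) ∧
        ∑' p : Nat.Primes, Real.log p * ((p : ℕ) : ℝ) ^ (-σ) ≤ 1 / (σ - 1) + K₀ := by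
  obtain ⟨K₀, hK₀, hK⟩ := exists_tsum_vonMangoldt_div_rpow_le
  refine ⟨K₀, hK₀, fun σ hσ hσ2 ↦ ?_⟩
  obtain ⟨hsum, hle⟩ := hK σ hσ hσ2
  have heq : ∀ p : Nat.Primes, Real.log p * ((p : ℕ) : ℝ) ^ (-σ) =
      ArithmeticFunction.vonMangoldt p / ((p : ℕ) : ℝ) ^ σ := fun p ↦ by
    rw [ArithmeticFunction.vonMangoldt_apply_prime p.prop, Real.rpow_neg (Nat.cast_nonneg _),
      div_eq_mul_inv]
  have hsub : Summable (fun p : Nat.Primes ↦ ArithmeticFunction.vonMangoldt p / ((p : ℕ) : ℝ) ^ σ) :=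
    hsum.subtype _
  refine ⟨hsub.congr fun p ↦ (heq p).symm, ?_⟩
  rw [tsum_congr heq]
  refine le_trans ?_ hle
  exact Summable.tsum_subtype_le (fun n : ℕ ↦ ArithmeticFunction.vonMangoldt n / (n : ℝ) ^ σ) _
    (fun n ↦ div_nonneg ArithmeticFunction.vonMangoldt_nonneg (Real.rpow_nonneg (Nat.cast_nonneg n) _))
    hsum

/-- **Montgomery–Vaughan 2001, Lemma 2, the range `|t| ≤ σ − 1`** ("it follows that
`|F(σ + it)| ≍ |F(σ)|` when `0 ≤ t ≤ σ − 1`"), proved with an absolute constant: there is `C > 0`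
such that for all totally multiplicative `f` with `|f| ≤ 1`, `1 < σ ≤ 2` and `|t| ≤ σ − 1`,
`|F(σ + it)| ≤ C |F(σ)|` and `|F(σ)| ≤ C |F(σ + it)|`. Proof: in (20),
`Σ_p p^{-σ}|p^{-it} − 1| ≤ |t| Σ_p log p · p^{-σ} ≤ (σ − 1)(1/(σ−1) + K₀) ≤ 1 + K₀`.
[cite: MontgomeryVaughan2001, Lemma 2 (proof)] -/
theorem MontgomeryVaughan2001.exists_norm_LSeries_shift_le_of_abs_le :
    ∃ C : ℝ, 0 < C ∧ ∀ f : ℕ →*₀ ℂ, (∀ n, ‖f n‖ ≤ 1) →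
      ∀ σ t : ℝ, 1 < σ → σ ≤ 2 → |t| ≤ σ - 1 →
        ‖LSeries (f ·) (σ + t * I)‖ ≤ C * ‖LSeries (f ·) σ‖ ∧
          ‖LSeries (f ·) σ‖ ≤ C * ‖LSeries (f ·) (σ + t * I)‖ := by
  obtain ⟨K₀, hK₀, hK⟩ := exists_tsum_primes_log_mul_rpow_le
  refine ⟨Real.exp 4 * Real.exp (1 + K₀), by positivity, fun f hf σ t hσ hσ2 ht ↦ ?_⟩
  obtain ⟨hsum, hle⟩ := hK σ hσ hσ2
  obtain ⟨h1, h2⟩ := MontgomeryVaughan2001.norm_LSeries_shift_le f hf hσ t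
  -- `S ≤ |t| Σ_p log p p^{-σ} ≤ (σ - 1)(1/(σ-1) + K₀) ≤ 1 + K₀`
  have hS : ∑' p : Nat.Primes, ((p : ℕ) : ℝ) ^ (-σ) * ‖((p : ℕ) : ℂ) ^ (-(t * I)) - 1‖ ≤ 1 + K₀ := by
    have hb : ∀ p : Nat.Primes, ((p : ℕ) : ℝ) ^ (-σ) * ‖((p : ℕ) : ℂ) ^ (-(t * I)) - 1‖ ≤
        |t| * (Real.log p * ((p : ℕ) : ℝ) ^ (-σ)) := fun p ↦ by
      have h0 : 0 ≤ ((p : ℕ) : ℝ) ^ (-σ) := Real.rpow_nonneg (Nat.cast_nonneg _) _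
      calc ((p : ℕ) : ℝ) ^ (-σ) * ‖((p : ℕ) : ℂ) ^ (-(t * I)) - 1‖
          ≤ ((p : ℕ) : ℝ) ^ (-σ) * (|t| * Real.log p) :=
            mul_le_mul_of_nonneg_left (norm_natCast_cpow_neg_mul_I_sub_one_le p t) h0
        _ = |t| * (Real.log p * ((p : ℕ) : ℝ) ^ (-σ)) := by ring
    have hstep : ∑' p : Nat.Primes, ((p : ℕ) : ℝ) ^ (-σ) * ‖((p : ℕ) : ℂ) ^ (-(t * I)) - 1‖ ≤
        ∑' p : Nat.Primes, |t| * (Real.log p * ((p : ℕ) : ℝ) ^ (-σ)) :=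
      Summable.tsum_le_tsum hb (summable_primes_rpow_mul_norm_twist_sub_one hσ t) (hsum.mul_left _)
    rw [tsum_mul_left] at hstep
    have hσ1 : 0 < σ - 1 := by linarith
    have htot : 0 ≤ ∑' p : Nat.Primes, Real.log p * ((p : ℕ) : ℝ) ^ (-σ) :=
      tsum_nonneg fun p ↦ mul_nonneg (Real.log_nonneg (by exact_mod_cast p.prop.one_lt.le))
        (Real.rpow_nonneg (Nat.cast_nonneg _) _)
    calc _ ≤ |t| * ∑' p : Nat.Primes, Real.log p * ((p : ℕ) : ℝ) ^ (-σ) := hstep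
      _ ≤ (σ - 1) * (1 / (σ - 1) + K₀) := mul_le_mul ht hle htot hσ1.le
      _ = 1 + (σ - 1) * K₀ := by field_simp
      _ ≤ 1 + K₀ := by nlinarith
  have hexp : Real.exp (∑' p : Nat.Primes, ((p : ℕ) : ℝ) ^ (-σ) * ‖((p : ℕ) : ℂ) ^ (-(t * I)) - 1‖) ≤
      Real.exp (1 + K₀) := Real.exp_le_exp.2 hS
  have hpos := norm_nonneg (LSeries (f ·) σ)
  have hpos' := norm_nonneg (LSeries (f ·) (σ + t * I))
  constructor
  · refine h1.trans ?_
    rw [mul_assoc, mul_assoc]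
    exact mul_le_mul_of_nonneg_left (mul_le_mul_of_nonneg_right hexp hpos) (Real.exp_pos 4).le
  · refine h2.trans ?_
    rw [mul_assoc, mul_assoc]
    exact mul_le_mul_of_nonneg_left (mul_le_mul_of_nonneg_right hexp hpos') (Real.exp_pos 4).le

end Literature.NumberTheory.LFunctions
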